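import Literature.NumberTheory.LFunctions.NoExceptionalZeroUpTo
import HarnessLib

/-!
# No real zero in `(0, 1)` up to a level `Q`: the WIDE criterion of a certified table of real
# characters (Platt / Watkins / Chua width) and its relation to `NoExceptionalZeroUpTo`

Topic `Literature/NumberTheory/LFunctions`. Definitions (`NoRealZeroUpTo`, `NoRealZeroOddUpTo`,
`NoRealZeroEvenUpTo`; reviewed) and THEOREMS (no named fact, no `sorry`). Companion of
`NoExceptionalZeroUpTo.lean` (the NARROW criterion `NoExceptionalZeroUpTo Q c₀`: no zero in
`[1 − c₀/log q, 1] ∩ (0, 1]`).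

The printed verifications of "no exceptional zero" come in two widths. Lu–Zaman–Zhao (Math. Comp.
2026) exclude real zeros `σ ≥ 1 − 1/(5 log q)` for all quadratic `χ` mod `q ≤ 10¹⁰` (narrow); Platt
(Math. Comp. 85 (2016), Thms. 7.1–7.2: GRH to height `10⁸/q` for primitive `χ` mod `q ≤ 4·10⁵`, and
`L(1/2, χ) ≠ 0`), Watkins (Math. Comp. 73 (2004): odd real `χ`, `d ≤ 3·10⁸`) and Chua (Math. Comp. 74
(2005): even, `q ≤ 2·10⁵`) exclude EVERY real zero in `(0, 1)` (wide). This file types the wide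
statement and its parity halves (the printed frontiers of odd and even characters differ), and
proves the relations a consumer needs:

* `NoRealZeroUpTo Q`, `NoRealZeroOddUpTo Q`, `NoRealZeroEvenUpTo Q`; `NoRealZeroUpTo.anti_level`,
  `NoRealZeroUpTo.iff_odd_and_even`;
* `NoRealZeroUpTo.noExceptionalZeroUpTo` — **W ⇒ N at every width**; `noRealZeroUpTo_of_log_le` —
  **N at width `c₀ ≥ log Q` ⇒ W** (so the two criteria agree at large width);
* `NoRealZeroUpTo.lfunction_ne_zero` — all quadratic `χ ≠ χ₀` mod `q ≤ Q`, imprimitive included;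
* `noRealZeroUpTo_platt : platt2016_theorem71 → platt2016_theorem72 → NoRealZeroUpTo 400000` — the
  printed even/odd wide range (conditional on the two named facts of
  `DirichletLRiemannHypothesisUpTo.lean`).

What is NOT here: Watkins' and Chua's theorems as named facts (texts not held first-hand), any
certificate checker, and the consumers.

## References

* D. J. Platt, *Numerical computations concerning the GRH*, Math. Comp. 85 (2016), 3009–3027,
  Theorems 7.1–7.2. [Platt2016GRH]
* M. Watkins, *Real zeros of real odd Dirichlet L-functions*, Math. Comp. 73 (2004), 415–423.
  [Watkins2004RealZeros]
* H. L. Montgomery, R. C. Vaughan, *Multiplicative Number Theory I*, CUP 2007, §10.1 (10.20),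
  Corollary 11.8. [MontgomeryVaughan2007]
-/

noncomputable section

open Complex Literature.Barriers.Parity

namespace Literature.NumberTheory.LFunctions

variable {Q : ℕ}

/-- For `q ≥ 3`, `log q > 1`. [folklore] -/
private theorem one_lt_log_of_three_le {q : ℕ} (hq : 3 ≤ q) : 1 < Real.log q := by
  have hq3 : (3 : ℝ) ≤ (q : ℝ) := by exact_mod_cast hq
  have hlog3 : 1 < Real.log 3 := by
    have h := Real.exp_one_lt_d9
    rw [Real.lt_log_iff_exp_lt (by norm_num)]
    linarith
  exact lt_of_lt_of_le hlog3 (Real.log_le_log (by norm_num) hq3)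

/-! ### The wide criterion -/

/-- **No real zero up to level `Q`** — the WIDE criterion, the width of Platt's GRH verification
(Thms. 7.1–7.2: every zero of `L(s, χ)`, `χ` primitive mod `q ≤ 4·10⁵`, in the strip up to height
`10⁸/q` is on the line, and `L(1/2, χ) ≠ 0`), of Watkins' table for odd characters and of Chua's
for even ones: for every modulus `3 ≤ q ≤ Q`, every quadratic primitive `χ` mod `q` and every real
`σ` with `0 < σ < 1`, `L(σ, χ) ≠ 0`. [cite: Platt2016GRH, Theorems 7.1 and 7.2] -/
def NoRealZeroUpTo (Q : ℕ) : Prop :=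
  ∀ (q : ℕ) [NeZero q], 3 ≤ q → q ≤ Q →
    ∀ χ : DirichletCharacter ℂ q, χ.IsQuadratic → χ.IsPrimitive →
      ∀ σ : ℝ, 0 < σ → σ < 1 → χ.LFunction σ ≠ 0

/-- The wide criterion for ODD characters (`χ(−1) = −1`; imaginary quadratic fields — Watkins'
column: "real zeros of real odd Dirichlet `L`-functions", no positive real zero for `d ≤ 3·10⁸`).
[cite: Watkins2004RealZeros, main theorem] -/
def NoRealZeroOddUpTo (Q : ℕ) : Prop :=
  ∀ (q : ℕ) [NeZero q], 3 ≤ q → q ≤ Q →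
    ∀ χ : DirichletCharacter ℂ q, χ.IsQuadratic → χ.IsPrimitive → χ.Odd →
      ∀ σ : ℝ, 0 < σ → σ < 1 → χ.LFunction σ ≠ 0

/-- The wide criterion for EVEN characters (`χ(−1) = 1`; real quadratic fields — in print only
through Platt's GRH verification, `q ≤ 4·10⁵`). [cite: Platt2016GRH, Theorems 7.1 and 7.2] -/
def NoRealZeroEvenUpTo (Q : ℕ) : Prop :=
  ∀ (q : ℕ) [NeZero q], 3 ≤ q → q ≤ Q →
    ∀ χ : DirichletCharacter ℂ q, χ.IsQuadratic → χ.IsPrimitive → χ.Even →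
      ∀ σ : ℝ, 0 < σ → σ < 1 → χ.LFunction σ ≠ 0

namespace NoRealZeroUpTo

/-- Antitone in the level. [cite: Platt2016GRH, Theorems 7.1 and 7.2] -/
theorem anti_level (h : NoRealZeroUpTo Q) {Q' : ℕ} (hQ : Q' ≤ Q) : NoRealZeroUpTo Q' :=
  fun q _ hq3 hqQ χ hquad hprim σ hσ0 hσ1 ↦ h q hq3 (hqQ.trans hQ) χ hquad hprim σ hσ0 hσ1

/-- The wide criterion splits by parity (every character is even or odd, Mathlib
`DirichletCharacter.even_or_odd`) — the printed frontiers of the two halves differ.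
[cite: Platt2016GRH, Theorems 7.1 and 7.2] -/
theorem iff_odd_and_even : NoRealZeroUpTo Q ↔ NoRealZeroOddUpTo Q ∧ NoRealZeroEvenUpTo Q := by
  constructor
  · intro h
    exact ⟨fun q _ hq3 hqQ χ hquad hprim _ σ hσ0 hσ1 ↦ h q hq3 hqQ χ hquad hprim σ hσ0 hσ1,
      fun q _ hq3 hqQ χ hquad hprim _ σ hσ0 hσ1 ↦ h q hq3 hqQ χ hquad hprim σ hσ0 hσ1⟩
  · rintro ⟨ho, he⟩ q _ hq3 hqQ χ hquad hprim σ hσ0 hσ1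
    rcases χ.even_or_odd with hev | hod
    · exact he q hq3 hqQ χ hquad hprim hev σ hσ0 hσ1
    · exact ho q hq3 hqQ χ hquad hprim hod σ hσ0 hσ1

/-- **Wide implies narrow at every width** (`W ⇒ N`): a window `[1 − c₀/log q, 1] ∩ (0, 1]` is part of
`(0, 1]`, and `L(1, χ) ≠ 0`. [cite: Platt2016GRH, Theorems 7.1 and 7.2] -/
theorem noExceptionalZeroUpTo (h : NoRealZeroUpTo Q) (c₀ : ℝ) : NoExceptionalZeroUpTo Q c₀ := by
  intro q _ hq3 hqQ χ hquad hprim σ hσ0 _ hσ1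
  rcases eq_or_lt_of_le hσ1 with rfl | hlt
  · have hne : χ ≠ 1 := SiegelZeroQuality.ne_one_of_isPrimitive hprim (by omega)
    exact DirichletCharacter.LFunction_ne_zero_of_one_le_re χ (Or.inl hne) (by simp)
  · exact h q hq3 hqQ χ hquad hprim σ hσ0 hlt

/-- The wide criterion controls every quadratic non-principal character up to level `Q`
(imprimitive included): `L(σ, χ) ≠ 0` for `0 < σ < 1` (apply `W ⇒ N` at width `c₀ = log q`, where
the narrow window is all of `(0, 1]`, and `NoExceptionalZeroUpTo.lfunction_ne_zero`).
[cite: MontgomeryVaughan2007, §10.1 (10.20) and Corollary 11.8] -/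
theorem lfunction_ne_zero (h : NoRealZeroUpTo Q) {q : ℕ} [NeZero q] (hqQ : q ≤ Q)
    (χ : DirichletCharacter ℂ q) (hquad : χ.IsQuadratic) (hχ : χ ≠ 1) {σ : ℝ} (hσ0 : 0 < σ) :
    χ.LFunction σ ≠ 0 := by
  have hq3 : 3 ≤ q := SiegelZeroPrimePairBarrierNarrow.three_le_level_of_ne_one χ hχ
  have hlogq : 0 < Real.log q := by linarith [one_lt_log_of_three_le hq3]
  refine (h.noExceptionalZeroUpTo (Real.log q)).lfunction_ne_zero hqQ χ hquad hχ hσ0 ?_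
  rw [div_self hlogq.ne']
  linarith

end NoRealZeroUpTo

/-- **Narrow at width `≥ log Q` is wide**: if `NoExceptionalZeroUpTo Q c₀` with `log Q ≤ c₀`, then
`NoRealZeroUpTo Q` (for `q ≤ Q`, `c₀/log q ≥ 1`, so the window `[1 − c₀/log q, 1] ∩ (0, 1]` is all of
`(0, 1]`). Together with `NoRealZeroUpTo.noExceptionalZeroUpTo` the two criteria agree at large width.
[cite: Platt2016GRH, Theorems 7.1 and 7.2] -/
theorem noRealZeroUpTo_of_log_le {Q : ℕ} {c₀ : ℝ} (h : NoExceptionalZeroUpTo Q c₀)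
    (hc : Real.log Q ≤ c₀) : NoRealZeroUpTo Q := by
  intro q _ hq3 hqQ χ hquad hprim σ hσ0 hσ1
  have hlogq : 0 < Real.log q := by linarith [one_lt_log_of_three_le hq3]
  have hqQ' : Real.log q ≤ Real.log Q :=
    Real.log_le_log (by exact_mod_cast (show 0 < q by omega)) (by exact_mod_cast hqQ)
  refine h q hq3 hqQ χ hquad hprim σ hσ0 ?_ hσ1.le
  have : 1 ≤ c₀ / Real.log q := by
    rw [le_div_iff₀ hlogq]; linarith
  linarith

/-- **Platt's range, wide form.** Platt 2016 Thm. 7.1 (GRH for primitive `χ` mod `q ≤ 4·10⁵` to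
height `≥ 10⁸/q`) and Thm. 7.2 (`L(1/2, χ) ≠ 0` for primitive `χ` mod `q ≤ 2·10⁶`) give
`NoRealZeroUpTo 400000`: a real zero `σ ∈ (0, 1)` lies on the critical line, so `σ = 1/2`, which
Thm. 7.2 excludes. (Conditional on the two named facts.) [cite: Platt2016GRH, Theorems 7.1 and 7.2] -/
theorem noRealZeroUpTo_platt (h71 : platt2016_theorem71) (h72 : platt2016_theorem72) :
    NoRealZeroUpTo 400000 := by
  intro q _ hq3 hqQ χ _ hprim σ hσ0 hσ1 hzero
  have hne : χ ≠ 1 := SiegelZeroQuality.ne_one_of_isPrimitive hprim (by omega)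
  have hgrh := grhUpTo_of_platt2016 (q := q) h71 hqQ χ hne
  have hhalf : ((σ : ℂ)).re = 1 / 2 :=
    hgrh σ hzero (by simpa using hσ0) (by simpa using hσ1)
      (by simp only [Complex.ofReal_im, abs_zero]; positivity)
  have hσ : σ = 1 / 2 := by simpa using hhalf
  subst hσ
  exact LFunction_one_half_ne_zero_of_platt2016 h72 (by omega) hne (by simpa using hzero)


end Literature.NumberTheory.LFunctions

end
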